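import Literature.NumberTheory.Rogawski1990.SingularLocalConjugacyArch
import Literature.NumberTheory.QuadraticForms.HermitianSignatureCongruence
import HarnessLib

/-!
# Local conjugacy at a SINGULAR semisimple class, archimedean clause in SIGN form: the block signatures of a framed hermitian form over
# `E ⊗ ℝ` are read off the TOTAL signature and the SIGN of the plane-block determinant (Rogawski 1990, §3.8 Prop. 3.8.1 (d) at `v ∣ ∞`)

Topic `NumberTheory/Rogawski1990`; namespace `Literature.NumberTheory.Rogawski1990`.  THEOREMS ONLY (no definition, no named fact, no instance, no
notation, no `sorry`).  Cell `pub/hodgecm-mathlib`, ENGINE T1 (crux H413 = `stmt-HodgeConjecture-24833`), row O7 «singular semisimple classes»: the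
SEQUEL of ★ (h3′) `SingularLocalConjugacyArch` named by the O7 OWNER RULE (F2) ∕ WORD #15 («the indefinite-place sign reading = the `hsig₁ hsig₂`
feed of (h3′)»).  HC_CM is proved only modulo the printed citations until rung 0 closes.

THE MATHEMATICS [Rogawski1990, §3.8 Prop. 3.8.1 (d) p. 30].  At a real place `ρ` of `F` (complex place `w` of `E` over it) the archimedean
obstruction to rational conjugacy inside the stable class of a singular semisimple `γ` (eigenvalues `a` on a plane, `b` on a line) is the SIGNATURE
of the restriction of the hermitian form to the `a`-plane; what the global bookkeeping delivers is only a SIGN — the sign at `ρ` of the plane-block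
determinant (the archimedean component of ★ `adelicBlockDet`, cf. ★ `PrincipalAdelicNormArch.exists_sign_eq_of_isPrincipalAdelicNorm`).  The two
agree: for an invertible hermitian block-diagonal `A₁ ⊕ᶠ a₂` over `ℂ` with `a₂` of size `1`, the inertia is additive (`#neg = #neg A₁ + #neg a₂`,
[HornJohnson2013, 4.5.P21 (a)] — ★ `card_eigenvalues_fromBlocks_zero_zero_eq_add`), `sign det A₁ = (−1)^{#neg A₁}` (`det` = product of the real
eigenvalues), and `#neg a₂ ∈ {0,1}` leaves `#neg A₁ ∈ {t − 1, t}` (`t` = total negative index), which its parity pins.  Hence **same total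
signature + same sign of `det` of the plane block ⇒ same block signatures** (§1), and ★ (h3′) becomes: **`G, G′` framed block-diagonal hermitian
over `E ⊗ ℝ` (frame `N₁ ⊕ 1`) with unit determinants, the same total positive index at every complex place (e.g. both `≅ H_∞`) and plane-block
determinants of the same sign at every complex place ⇒ `∃ t ∈ GL(E ⊗ ℝ)`, `t γ = γ t`, `ᵗ((c⊗1)t) G t = G′`** (§2; CM edition §3).  For a ternary
form of signature `(2,1)` at `ρ`: plane block `(2,0)` iff its determinant is positive, `(1,1)` iff negative.

WHAT IS PROVED
* §1 (over `ℂ`) `card_eigenvalues_finSum_eq_add` (inertia of `A₁ ⊕ᶠ A₂`, any eigenvalue predicate), `card_pos_add_card_neg_eigenvalues_eq_card`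
  (`det ≠ 0` ⇒ `#pos + #neg = n`), `re_det_pos_iff_even_card_neg_eigenvalues` (`0 < Re det A ↔ #neg even`),
  **`card_pos_eigenvalues_blocks_eq_of_finSum_of_det`** (frame `N₁ ⊕ 1`: equal totals + same sign of `det` of the `N₁`-blocks ⇒ equal block indices).
* §2 (over `E ⊗ ℝ`, `c ≠ 1` fixing all infinite places) **`exists_commute_twistGram_conjMixed_eq_of_signatures_of_det_sign`** — ★ (h3′) with
  `(hsig : ∀ w h₁ h₂, #pos G_w = #pos G′_w)` (totals) and `(hsgn : ∀ w, 0 < Re (det G₁)_w ↔ 0 < Re (det G′₁)_w)` in place of the block signatures.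
* §3 CM edition `exists_commute_twistGram_arch_eq_of_signatures_of_det_sign_cm` (`σ_∞ := conjMixed L⁺ L (complexConj L)`; `N₁ := 2` for `U(3)`).

## References
* [Rogawski1990] J. D. Rogawski, *Automorphic Representations of Unitary Groups in Three Variables*, Ann. of Math. Stud. 123 (1990), §3.8
  Prop. 3.8.1 (d) p. 30 (the sign condition at the places in `S₀`), §3.3 Prop. 3.3.1 p. 22.
* [HornJohnson2013] R. A. Horn, C. R. Johnson, *Matrix Analysis*, 2nd ed., CUP 2013, Thm. 4.1.5 (spectral theorem), Thm. 4.5.8 (Sylvester),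
  4.5.P21 (inertia of a direct sum), 1.1.P4.
* [BorelJacquet1979] A. Borel, H. Jacquet, PSPM 33.1 (1979), §4.1 (`G(E ⊗ ℝ) = ∏_{w∣∞} G(E_w)`).
-/

set_option autoImplicit false

noncomputable section

open NumberField NumberField.InfinitePlace Matrix
open scoped Matrix MatrixGroups ComplexConjugate ComplexOrder

namespace Literature.NumberTheory.Rogawski1990

open Literature.NumberTheory.Automorphic.UnitaryGroup (finSum finSum_map det_finSum transpose_finSum_map conjMixed evalC evalC_apply
  evalC_conjMixed mixedSpace_ext complexConj_smul_infinitePlace)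
open NumberField.mixedEmbedding (mixedSpace)

/-! ## §1 Over `ℂ`: inertia of `A₁ ⊕ᶠ A₂`, the sign of `det`, and the `N₁ ⊕ 1` reading -/

section Complex

variable {N₁ N₂ : ℕ}

/-- Eigenvalue counts of a hermitian matrix are read off the roots of its characteristic polynomial (with multiplicity). [folklore] -/
private theorem card_eigenvalues_eq_countP_roots' {n : Type} [Fintype n] [DecidableEq n] {H : Matrix n n ℂ} (hH : H.IsHermitian)
    (p : ℝ → Prop) [DecidablePred p] :
    (Finset.univ.filter fun i => p (hH.eigenvalues i)).card = H.charpoly.roots.countP (fun z => p (RCLike.re z)) := by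
  rw [hH.roots_charpoly_eq_eigenvalues, Multiset.countP_map, Finset.card_def, Finset.filter_val]
  congr 1

/-- **Inertia of a direct sum `A₁ ⊕ᶠ A₂`**: every eigenvalue count of `A₁ ⊕ᶠ A₂` is the sum of the counts of the blocks (★
`card_eigenvalues_fromBlocks_zero_zero_eq_add` transported along the reindexing `Fin N₁ ⊕ Fin N₂ ≃ Fin (N₁ + N₂)`, which does not change the
characteristic polynomial). [cite: HornJohnson2013, 4.5.P21 (a), 1.1.P4 (`σ(A ⊕ D) = σ(A) ∪ σ(D)`)] -/
theorem card_eigenvalues_finSum_eq_add {A₁ : Matrix (Fin N₁) (Fin N₁) ℂ} {A₂ : Matrix (Fin N₂) (Fin N₂) ℂ} (h₁ : A₁.IsHermitian)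
    (h₂ : A₂.IsHermitian) (h : (finSum N₁ N₂ A₁ A₂).IsHermitian) (p : ℝ → Prop) [DecidablePred p] :
    (Finset.univ.filter fun i => p (h.eigenvalues i)).card =
      (Finset.univ.filter fun i => p (h₁.eigenvalues i)).card + (Finset.univ.filter fun i => p (h₂.eigenvalues i)).card := by
  have hAD : (Matrix.fromBlocks A₁ 0 0 A₂).IsHermitian := h₁.fromBlocks (by rw [Matrix.conjTranspose_zero]) h₂
  have hchar : (finSum N₁ N₂ A₁ A₂).charpoly = (Matrix.fromBlocks A₁ 0 0 A₂).charpoly := by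
    rw [finSum, Matrix.charpoly_reindex]
  rw [card_eigenvalues_eq_countP_roots' h, hchar, ← card_eigenvalues_eq_countP_roots' hAD]
  exact Literature.LinearAlgebra.Matrix.card_eigenvalues_fromBlocks_zero_zero_eq_add h₁ h₂ hAD p

/-- For an invertible hermitian matrix, `#pos + #neg = n` (no zero eigenvalues: `det = ∏ λᵢ`).
[cite: HornJohnson2013, Thm. 4.5.8 (inertia of a nonsingular Hermitian matrix)] -/
theorem card_pos_add_card_neg_eigenvalues_eq_card {n : Type} [Fintype n] [DecidableEq n] {A : Matrix n n ℂ} (hA : A.IsHermitian)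
    (hA0 : A.det ≠ 0) :
    (Finset.univ.filter fun i => 0 < hA.eigenvalues i).card + (Finset.univ.filter fun i => hA.eigenvalues i < 0).card = Fintype.card n := by
  have hz : (Finset.univ.filter fun i => hA.eigenvalues i = 0).card = 0 := by
    rw [Finset.card_eq_zero, Finset.filter_eq_empty_iff]
    intro i _ hi
    apply hA0
    rw [hA.det_eq_prod_eigenvalues]
    exact Finset.prod_eq_zero (Finset.mem_univ i) (by rw [hi]; simp)
  have h3 := Literature.LinearAlgebra.Matrix.card_pos_add_card_neg_add_card_zero_eigenvalues hA
  rw [hz, add_zero] at h3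
  exact h3

/-- **The sign of the determinant of an invertible hermitian matrix is `(−1)^{#neg}`**: `det A` is real and positive iff the number of negative
eigenvalues is even (`det A = ∏ λᵢ`). [cite: HornJohnson2013, Thm. 4.1.5 (spectral theorem; `det` = product of the real eigenvalues)] -/
theorem re_det_pos_iff_even_card_neg_eigenvalues {n : Type} [Fintype n] [DecidableEq n] {A : Matrix n n ℂ} (hA : A.IsHermitian)
    (hA0 : A.det ≠ 0) :
    0 < A.det.re ↔ Even (Finset.univ.filter fun i => hA.eigenvalues i < 0).card := by
  have hne : ∀ i, hA.eigenvalues i ≠ 0 := by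
    intro i hi
    apply hA0
    rw [hA.det_eq_prod_eigenvalues]
    exact Finset.prod_eq_zero (Finset.mem_univ i) (by rw [hi]; simp)
  -- `det A = ∏ λᵢ`, a real number
  have hdet : A.det.re = ∏ i, hA.eigenvalues i := by
    rw [hA.det_eq_prod_eigenvalues]
    have : (∏ i, (RCLike.ofReal (hA.eigenvalues i) : ℂ)) = ((∏ i, hA.eigenvalues i : ℝ) : ℂ) := by
      rw [Complex.ofReal_prod]
      rfl
    rw [this, Complex.ofReal_re]
  -- `∏ λᵢ = (∏ |λᵢ|) · (−1)^{#neg}`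
  have hsplit : (∏ i, hA.eigenvalues i) =
      (∏ i, |hA.eigenvalues i|) * (-1) ^ (Finset.univ.filter fun i => hA.eigenvalues i < 0).card := by
    have hfac : ∀ i, hA.eigenvalues i = |hA.eigenvalues i| * (if hA.eigenvalues i < 0 then (-1 : ℝ) else 1) := by
      intro i
      split_ifs with h
      · rw [abs_of_neg h]; ring
      · rw [abs_of_nonneg (not_lt.mp h), mul_one]
    conv_lhs => rw [show (fun i => hA.eigenvalues i) = fun i => |hA.eigenvalues i| * (if hA.eigenvalues i < 0 then (-1 : ℝ) else 1) from
      funext hfac]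
    rw [Finset.prod_mul_distrib, Finset.prod_ite, Finset.prod_const_one, mul_one, Finset.prod_const]
  have hpos : 0 < ∏ i, |hA.eigenvalues i| := Finset.prod_pos fun i _ => abs_pos.mpr (hne i)
  rw [hdet, hsplit]
  constructor
  · intro h
    by_contra hodd
    rw [Nat.not_even_iff_odd] at hodd
    rw [hodd.neg_one_pow, mul_neg, mul_one] at h
    linarith
  · intro h
    rw [h.neg_one_pow, mul_one]
    exact hpos

/-- **SAME TOTAL SIGNATURE + SAME SIGN OF THE PLANE-BLOCK DETERMINANT ⇒ SAME BLOCK SIGNATURES** (frame `N₁ ⊕ 1`).  For invertible hermitian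
block-diagonal `A₁ ⊕ᶠ a₂`, `A′₁ ⊕ᶠ a′₂` over `ℂ` with `a₂, a′₂` of size `1`: if the totals have the same positive index and `det A₁`, `det A′₁` have
the same sign, then `#pos A₁ = #pos A′₁` and `#pos a₂ = #pos a′₂` — since `#neg a₂ ∈ {0, 1}`, `#neg A₁ ∈ {t − 1, t}` (`t` the total negative index)
is pinned by its parity `sign det A₁ = (−1)^{#neg A₁}`.  (At a real place where a ternary hermitian form has signature `(2,1)`: the plane block is
`(2,0)` iff its determinant is positive, `(1,1)` iff negative — the archimedean half of the `|𝓡| = 2` obstruction at a singular class.)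
[cite: Rogawski1990, §3.8 Prop. 3.8.1 (d) p. 30 (the sign condition at the places in `S₀`)] [cite: HornJohnson2013, Thm. 4.5.8, 4.5.P21] -/
theorem card_pos_eigenvalues_blocks_eq_of_finSum_of_det {A₁ A'₁ : Matrix (Fin N₁) (Fin N₁) ℂ} {a₂ a'₂ : Matrix (Fin 1) (Fin 1) ℂ}
    (h₁ : A₁.IsHermitian) (h'₁ : A'₁.IsHermitian) (h₂ : a₂.IsHermitian) (h'₂ : a'₂.IsHermitian)
    (h : (finSum N₁ 1 A₁ a₂).IsHermitian) (h' : (finSum N₁ 1 A'₁ a'₂).IsHermitian)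
    (hA0 : A₁.det ≠ 0) (hA'0 : A'₁.det ≠ 0) (ha0 : a₂.det ≠ 0) (ha'0 : a'₂.det ≠ 0)
    (htot : (Finset.univ.filter fun i => 0 < h.eigenvalues i).card = (Finset.univ.filter fun i => 0 < h'.eigenvalues i).card)
    (hsgn : 0 < A₁.det.re ↔ 0 < A'₁.det.re) :
    (Finset.univ.filter fun i => 0 < h₁.eigenvalues i).card = (Finset.univ.filter fun i => 0 < h'₁.eigenvalues i).card ∧
      (Finset.univ.filter fun i => 0 < h₂.eigenvalues i).card = (Finset.univ.filter fun i => 0 < h'₂.eigenvalues i).card := by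
  have e₁ := card_pos_add_card_neg_eigenvalues_eq_card h₁ hA0
  have e'₁ := card_pos_add_card_neg_eigenvalues_eq_card h'₁ hA'0
  have e₂ := card_pos_add_card_neg_eigenvalues_eq_card h₂ ha0
  have e'₂ := card_pos_add_card_neg_eigenvalues_eq_card h'₂ ha'0
  have s := card_eigenvalues_finSum_eq_add h₁ h₂ h (fun x => 0 < x)
  have s' := card_eigenvalues_finSum_eq_add h'₁ h'₂ h' (fun x => 0 < x)
  have par : Even (Finset.univ.filter fun i => h₁.eigenvalues i < 0).card ↔ Even (Finset.univ.filter fun i => h'₁.eigenvalues i < 0).card := by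
    rw [← re_det_pos_iff_even_card_neg_eigenvalues h₁ hA0, ← re_det_pos_iff_even_card_neg_eigenvalues h'₁ hA'0]
    exact hsgn
  rw [Nat.even_iff, Nat.even_iff] at par
  simp only [Fintype.card_fin] at e₁ e'₁ e₂ e'₂
  omega

end Complex

/-! ## §2 Over `E ⊗ ℝ`: the archimedean clause in SIGN form (frame `N₁ ⊕ 1`) -/

section Mixed

variable (F E : Type) [Field F] [Field E] [NumberField E] [Algebra F E] (c : E ≃ₐ[F] E)
  (hc : c ≠ 1) (hfix : ∀ w : InfinitePlace E, c • w = w) {N₁ : ℕ}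

/-- `⊕ᶠ` is injective in the pair of blocks. [folklore] -/
private theorem finSum_injective_pair' {S : Type*} [CommRing S] {N₂ : ℕ} {A C : Matrix (Fin N₁) (Fin N₁) S} {B D : Matrix (Fin N₂) (Fin N₂) S}
    (h : finSum N₁ N₂ A B = finSum N₁ N₂ C D) : A = C ∧ B = D := by
  have h' := (Matrix.reindex finSumFinEquiv finSumFinEquiv).injective h
  rw [Matrix.fromBlocks_inj] at h'
  exact ⟨h'.1, h'.2.2.2⟩

/-- The blocks of a hermitian block-diagonal matrix are hermitian. [folklore] -/
private theorem blocks_hermitian_pair' {S : Type*} [CommRing S] (σ : S →+* S) {N₂ : ℕ} {G₁ : Matrix (Fin N₁) (Fin N₁) S}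
    {G₂ : Matrix (Fin N₂) (Fin N₂) S} (h : ((finSum N₁ N₂ G₁ G₂).map σ)ᵀ = finSum N₁ N₂ G₁ G₂) : (G₁.map σ)ᵀ = G₁ ∧ (G₂.map σ)ᵀ = G₂ := by
  rw [transpose_finSum_map] at h
  exact finSum_injective_pair' h

omit [NumberField E] in
include hc hfix in
/-- **THE ARCHIMEDEAN CLAUSE OF LOCAL CONJUGACY AT A SINGULAR CLASS, SIGN FORM** (frame `N₁ ⊕ 1`, e.g. `2 ⊕ 1` for `U(3)`).  As ★ (h3′)
`exists_commute_twistGram_conjMixed_eq_of_block_signatures`, but with the two block-signature hypotheses replaced by what the singular obstruction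
actually reads: (i) `G_w`, `G′_w` have the same TOTAL positive index at every complex place `w` (e.g. both congruent to `H_w`), and (ii) the plane-block
determinants `det G₁`, `det G′₁` have the SAME SIGN at every `w`.  Conclusion: some `t ∈ GL(E ⊗ ℝ)` commutes with `γ` and has `ᵗ((c⊗1)t) · G · t = G′`.
(§1 `card_pos_eigenvalues_blocks_eq_of_finSum_of_det` place by place: the total index of `G_w` is that of `G₁_w ⊕ᶠ G₂_w` by Sylvester ★
`Landherr.card_pos_eigenvalues_eq_of_congr` along the invertible `P_w`.) [cite: Rogawski1990, §3.8 Prop. 3.8.1 (d) p. 30; §3.3 Prop. 3.3.1 p. 22]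
[cite: HornJohnson2013, Thm. 4.5.8] -/
theorem exists_commute_twistGram_conjMixed_eq_of_signatures_of_det_sign
    {γ G G' : Matrix (Fin (N₁ + 1)) (Fin (N₁ + 1)) (mixedSpace E)} {P : GL (Fin (N₁ + 1)) (mixedSpace E)} {a b : mixedSpace E}
    (hG : (G.map (conjMixed F E c))ᵀ = G) (hG' : (G'.map (conjMixed F E c))ᵀ = G') (hGd : IsUnit G.det) (hG'd : IsUnit G'.det)
    (hγP : γ * P.val = P.val *
      finSum N₁ 1 (a • (1 : Matrix (Fin N₁) (Fin N₁) (mixedSpace E))) (b • (1 : Matrix (Fin 1) (Fin 1) (mixedSpace E))))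
    {G₁ G'₁ : Matrix (Fin N₁) (Fin N₁) (mixedSpace E)} {G₂ G'₂ : Matrix (Fin 1) (Fin 1) (mixedSpace E)}
    (hGP : twistGram (conjMixed F E c) G P.val = finSum N₁ 1 G₁ G₂)
    (hG'P : twistGram (conjMixed F E c) G' P.val = finSum N₁ 1 G'₁ G'₂)
    (hsig : ∀ (w : {w : InfinitePlace E // IsComplex w}) (h₁ : (G.map (evalC E w)).IsHermitian) (h₂ : (G'.map (evalC E w)).IsHermitian),
      (Finset.univ.filter fun i => 0 < h₁.eigenvalues i).card = (Finset.univ.filter fun i => 0 < h₂.eigenvalues i).card)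
    (hsgn : ∀ w : {w : InfinitePlace E // IsComplex w}, 0 < (evalC E w G₁.det).re ↔ 0 < (evalC E w G'₁.det).re) :
    ∃ t : GL (Fin (N₁ + 1)) (mixedSpace E),
      t.val * γ = γ * t.val ∧ twistGram (conjMixed F E c) G t.val = G' := by
  have hσ : ∀ x, conjMixed F E c (conjMixed F E c x) = x := conjMixed_conjMixed_apply F E c hc hfix
  -- the blocks are hermitian with unit determinants
  have hPG : ((twistGram (conjMixed F E c) G P.val).map (conjMixed F E c))ᵀ = twistGram (conjMixed F E c) G P.val :=
    conjTranspose_twistGram _ _ hσ hG _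
  have hPG' : ((twistGram (conjMixed F E c) G' P.val).map (conjMixed F E c))ᵀ = twistGram (conjMixed F E c) G' P.val :=
    conjTranspose_twistGram _ _ hσ hG' _
  rw [hGP] at hPG
  rw [hG'P] at hPG'
  obtain ⟨hb₁, hb₂⟩ := blocks_hermitian_pair' (conjMixed F E c) hPG
  obtain ⟨hb'₁, hb'₂⟩ := blocks_hermitian_pair' (conjMixed F E c) hPG'
  have hdG : G₁.det * G₂.det = conjMixed F E c P.val.det * G.det * P.val.det := by rw [← det_finSum, ← hGP, det_twistGram]
  have hdG' : G'₁.det * G'₂.det = conjMixed F E c P.val.det * G'.det * P.val.det := by rw [← det_finSum, ← hG'P, det_twistGram]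
  have hPd : IsUnit P.val.det := Matrix.isUnits_det_units P
  have hu : IsUnit (G₁.det * G₂.det) := hdG ▸ ((hPd.map (conjMixed F E c)).mul hGd).mul hPd
  have hu' : IsUnit (G'₁.det * G'₂.det) := hdG' ▸ ((hPd.map (conjMixed F E c)).mul hG'd).mul hPd
  -- at a place: hermitian blocks with nonzero determinants
  have herm : ∀ {k : ℕ} {X : Matrix (Fin k) (Fin k) (mixedSpace E)}, (X.map (conjMixed F E c))ᵀ = X →
      ∀ w : {w : InfinitePlace E // IsComplex w}, (X.map (evalC E w)).IsHermitian :=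
    fun hX w => isHermitian_map_evalC_of_transpose_map_conjMixed F E c hc hfix hX w
  have hdz : ∀ {k : ℕ} {X : Matrix (Fin k) (Fin k) (mixedSpace E)}, IsUnit X.det →
      ∀ w : {w : InfinitePlace E // IsComplex w}, (X.map (evalC E w)).det ≠ 0 := fun hX w => by
    rw [← RingHom.mapMatrix_apply, ← RingHom.map_det]
    exact (hX.map _).ne_zero
  -- the total index of `G_w` is that of `(G₁)_w ⊕ᶠ (G₂)_w`
  have htot : ∀ {X : Matrix (Fin (N₁ + 1)) (Fin (N₁ + 1)) (mixedSpace E)} {X₁ : Matrix (Fin N₁) (Fin N₁) (mixedSpace E)}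
      {X₂ : Matrix (Fin 1) (Fin 1) (mixedSpace E)} (hX : (X.map (conjMixed F E c))ᵀ = X)
      (hXP : twistGram (conjMixed F E c) X P.val = finSum N₁ 1 X₁ X₂) (w : {w : InfinitePlace E // IsComplex w})
      (hf : (finSum N₁ 1 (X₁.map (evalC E w)) (X₂.map (evalC E w))).IsHermitian),
      (Finset.univ.filter fun i => 0 < (herm hX w).eigenvalues i).card = (Finset.univ.filter fun i => 0 < hf.eigenvalues i).card := by
    intro X X₁ X₂ hX hXP w hf
    refine QuadraticForms.Landherr.card_pos_eigenvalues_eq_of_congr (herm hX w) hf (g := P.val.map (evalC E w)) ?_ ?_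
    · rw [← RingHom.mapMatrix_apply, ← RingHom.map_det]
      exact (Matrix.isUnits_det_units P).map _
    · rw [← twistGram_conjMixed_map_evalC F E c hc hfix, hXP, finSum_map]
  refine exists_commute_twistGram_conjMixed_eq_of_block_signatures F E c hc hfix hG hG' hGd hG'd hγP hGP hG'P (fun w h₁ h₂ => ?_)
    (fun w h₁ h₂ => ?_)
  all_goals
    have hf : (finSum N₁ 1 (G₁.map (evalC E w)) (G₂.map (evalC E w))).IsHermitian := by
      rw [← finSum_map]; exact herm hPG w
    have hf' : (finSum N₁ 1 (G'₁.map (evalC E w)) (G'₂.map (evalC E w))).IsHermitian := by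
      rw [← finSum_map]; exact herm hPG' w
    have key := card_pos_eigenvalues_blocks_eq_of_finSum_of_det (herm hb₁ w) (herm hb'₁ w) (herm hb₂ w) (herm hb'₂ w) hf hf'
      (hdz (isUnit_of_mul_isUnit_left hu) w) (hdz (isUnit_of_mul_isUnit_left hu') w) (hdz (isUnit_of_mul_isUnit_right hu) w)
      (hdz (isUnit_of_mul_isUnit_right hu') w)
      (by rw [← htot hG hGP w hf, ← htot hG' hG'P w hf']; exact hsig w (herm hG w) (herm hG' w))
      (by
        have e₁ : (G₁.map (evalC E w)).det = evalC E w G₁.det := by rw [← RingHom.mapMatrix_apply, ← RingHom.map_det]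
        have e'₁ : (G'₁.map (evalC E w)).det = evalC E w G'₁.det := by rw [← RingHom.mapMatrix_apply, ← RingHom.map_det]
        rw [e₁, e'₁]; exact hsgn w)
  · exact key.1
  · exact key.2

end Mixed

/-! ## §3 CM edition -/

section CM

variable (L : Type) [Field L] [NumberField L] [IsCMField L] {N₁ : ℕ}

/-- **CM edition of the sign form** (`F = L⁺`, `E = L`, `c = complexConj L`, frame `N₁ ⊕ 1`; `N₁ := 2` for `U(3)`): same total signature at
every complex place + same sign of the plane-block determinant at every complex place ⇒ a `γ`-centralising `t ∈ GL(L ⊗ ℝ)` with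
`ᵗ(σ_∞ t) · G · t = G′`. [cite: Rogawski1990, §3.8 Prop. 3.8.1 (d) p. 30; §3.3 Prop. 3.3.1 p. 22] [cite: HornJohnson2013, Thm. 4.5.8] -/
theorem exists_commute_twistGram_arch_eq_of_signatures_of_det_sign_cm
    {γ G G' : Matrix (Fin (N₁ + 1)) (Fin (N₁ + 1)) (mixedSpace L)} {P : GL (Fin (N₁ + 1)) (mixedSpace L)} {a b : mixedSpace L}
    (hG : (G.map (conjMixed (↥(maximalRealSubfield L)) L (IsCMField.complexConj L)))ᵀ = G)
    (hG' : (G'.map (conjMixed (↥(maximalRealSubfield L)) L (IsCMField.complexConj L)))ᵀ = G') (hGd : IsUnit G.det) (hG'd : IsUnit G'.det)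
    (hγP : γ * P.val = P.val *
      finSum N₁ 1 (a • (1 : Matrix (Fin N₁) (Fin N₁) (mixedSpace L))) (b • (1 : Matrix (Fin 1) (Fin 1) (mixedSpace L))))
    {G₁ G'₁ : Matrix (Fin N₁) (Fin N₁) (mixedSpace L)} {G₂ G'₂ : Matrix (Fin 1) (Fin 1) (mixedSpace L)}
    (hGP : twistGram (conjMixed (↥(maximalRealSubfield L)) L (IsCMField.complexConj L)) G P.val = finSum N₁ 1 G₁ G₂)
    (hG'P : twistGram (conjMixed (↥(maximalRealSubfield L)) L (IsCMField.complexConj L)) G' P.val = finSum N₁ 1 G'₁ G'₂)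
    (hsig : ∀ (w : {w : InfinitePlace L // IsComplex w}) (h₁ : (G.map (evalC L w)).IsHermitian) (h₂ : (G'.map (evalC L w)).IsHermitian),
      (Finset.univ.filter fun i => 0 < h₁.eigenvalues i).card = (Finset.univ.filter fun i => 0 < h₂.eigenvalues i).card)
    (hsgn : ∀ w : {w : InfinitePlace L // IsComplex w}, 0 < (evalC L w G₁.det).re ↔ 0 < (evalC L w G'₁.det).re) :
    ∃ t : GL (Fin (N₁ + 1)) (mixedSpace L),
      t.val * γ = γ * t.val ∧ twistGram (conjMixed (↥(maximalRealSubfield L)) L (IsCMField.complexConj L)) G t.val = G' :=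
  exists_commute_twistGram_conjMixed_eq_of_signatures_of_det_sign _ L _ (IsCMField.complexConj_ne_one L) (complexConj_smul_infinitePlace L)
    hG hG' hGd hG'd hγP hGP hG'P hsig hsgn

end CM


end Literature.NumberTheory.Rogawski1990

end
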